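import Mathlib
import Literature.Computability.Complexity.CNF
import Literature.Computability.Complexity.CoinCounting
import Literature.Computability.Complexity.ApproximateCounting
import Literature.Computability.Complexity.StockmeyerMachines
import Literature.Computability.Complexity.OracleEmpty
import Literature.Computability.Complexity.OracleProofs
import Literature.Computability.Complexity.LengthCompare
import Literature.Computability.Complexity.CodeFPStrings
import Literature.Computability.Complexity.CodeFPLists
import Literature.Computability.Complexity.CodeFPListKit
import Literature.Computability.Complexity.SumcheckMAReferee
import Literature.Computability.Complexity.E3InstanceMachine
import Summits.PneNP.PneNP.Theses.WitnessForging
import Summits.PneNP.PneNP.Theorems.WitnessForgingSatBridgeDefs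

/-!
# Route WitnessForging — support item `SatBridge` (stmt-PneNP-2432), part 2: solution counts

The self-reducibility counts of a CNF and their approximate counter (Stockmeyer, tree theorem
`StockMachine.stockmeyerApproxCounting_holds`, at the empty oracle):

* basic facts: `extCount_split` (`#w = #w0 + #w1`), `extCount_nil_pos`, `extCount_self`,
  `extCount_take_pos`, `extCount_le_two_pow`;
* `codeFP_evalStr`, `codeFP_solPred` — polynomial time on codes (`CodeFP`, over the code
  `SumcheckMA.cnfE` = `encodingCNF.encode`, `SumcheckMA.cnfE_eq`; `numVars` by `Expander.E3LC.numVarsFP`);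
* `exists_solRel` — the counting relation `R ∈ P` with `countWitnesses R (n-|w|) ⟨enc φ, w⟩ = extCount φ w`;
* **`exists_counter`** — an `NP` language `L`, a transducer `F ∈ FP^L` and a coin polynomial `c`
  approximating `extCount φ w` within `1 + 1/k` except with probability `≤ 1/k`.
-/

set_option linter.dupNamespace false -- `Summit.PneNP.PneNP.…`: summit = sub-problem (D-0017)

namespace Summit.PneNP.PneNP.Theorems.SatBridgeJVV

open Literature.Computability.Complexity
open _root_.Computability Polynomial Brick CodeFP
open Literature.Computability.Complexity.SumcheckMA (litE cnfE cnfE_eq cnfRawOfList)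

/-! ### Basic facts on the extension counts -/

/-- Membership in `Sol`. [folklore] -/
theorem mem_Sol_iff (φ : CNF ℕ) (y : List Bool) :
    y ∈ Sol φ ↔ y.length = φ.numVars ∧ φ.eval (fun i => y.getD i false) = true := Iff.rfl

/-- **Self-reducibility**: for `|w| < n`, `#(w) = #(w0) + #(w1)`. [cite: JerrumValiantVazirani1986, §3] -/
theorem extCount_split (φ : CNF ℕ) {w : List Bool} (hw : w.length < φ.numVars) :
    extCount φ w = extCount φ (w ++ [false]) + extCount φ (w ++ [true]) := by
  unfold extCount
  obtain ⟨m, hm⟩ : ∃ m, φ.numVars - w.length = m + 1 := ⟨φ.numVars - w.length - 1, by omega⟩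
  have h0 : φ.numVars - (w ++ [false]).length = m := by simp; omega
  have h1 : φ.numVars - (w ++ [true]).length = m := by simp; omega
  rw [hm, h0, h1, cnt_succ]
  congr 1
  · exact cnt_congr fun z _ => by simp
  · exact cnt_congr fun z _ => by simp

/-- The evaluation of `φ` only depends on the variables below `numVars φ`. [folklore] -/
theorem eval_congr_lt (φ : CNF ℕ) {σ τ : ℕ → Bool} (h : ∀ i < φ.numVars, σ i = τ i) :
    φ.eval σ = φ.eval τ := by
  rw [Bool.eq_iff_iff]
  simp only [CNF.eval, List.all_eq_true, List.any_eq_true, Literal.eval]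
  refine forall₂_congr fun c hc => exists_congr fun l => and_congr_right fun hl => ?_
  rw [h l.1 (CNF.lt_numVars_of_mem_of_mem hc hl)]

/-- **A satisfiable CNF has a solution string**: `Sol φ` is nonempty, i.e. `#(ε) ≥ 1`. [folklore] -/
theorem extCount_nil_pos {φ : CNF ℕ} (hφ : φ.Satisfiable) : 0 < extCount φ [] := by
  obtain ⟨σ, hσ⟩ := hφ
  unfold extCount
  rw [cnt_pos_iff]
  refine ⟨List.ofFn fun i : Fin φ.numVars => σ i, by simp, ?_⟩
  simp only [List.nil_append, Set.mem_setOf_eq, mem_Sol_iff, List.length_ofFn, true_and]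
  rw [← hσ]
  apply eval_congr_lt
  intro i hi
  rw [List.getD_eq_getElem?_getD, List.getElem?_ofFn]
  simp [hi]

/-- A solution has exactly one extension of length `0`: `#(y) = 1` for `y ∈ Sol φ`. [folklore] -/
theorem extCount_self {φ : CNF ℕ} {y : List Bool} (hy : y ∈ Sol φ) : extCount φ y = 1 := by
  classical
  unfold extCount
  rw [hy.1, Nat.sub_self, cnt_zero]
  simp [hy]

/-- Along a solution every prefix has an extension: `#(y ↾ i) ≥ 1`. [folklore] -/
theorem extCount_take_pos {φ : CNF ℕ} {y : List Bool} (hy : y ∈ Sol φ) (i : ℕ) (hi : i ≤ φ.numVars) :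
    0 < extCount φ (y.take i) := by
  unfold extCount
  rw [cnt_pos_iff]
  refine ⟨y.drop i, ?_, by simpa using hy⟩
  have := hy.1
  simp [List.length_take, List.length_drop]
  omega

/-- `#(w) ≤ 2^{n - |w|}`. [folklore] -/
theorem extCount_le_two_pow (φ : CNF ℕ) (w : List Bool) :
    extCount φ w ≤ 2 ^ (φ.numVars - w.length) :=
  cnt_le _ _

/-- `#(w) ≤ 2^n`. [folklore] -/
theorem extCount_le_two_pow' (φ : CNF ℕ) (w : List Bool) : extCount φ w ≤ 2 ^ φ.numVars :=
  (extCount_le_two_pow φ w).trans (Nat.pow_le_pow_right (by norm_num) (Nat.sub_le _ _))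

/-! ### Polynomial time on codes -/

/-- **Evaluation on codes**: `(φ, y) ↦ φ.eval (y.getD · false)`. [folklore] -/
theorem codeFP_evalStr : CodeFP (pairE cnfE strE) bitE
    (fun p : CNF ℕ × List Bool => p.1.eval fun i => p.2.getD i false) := by
  -- literal value with context `y`
  have hlit : CodeFP (pairE strE litE) bitE
      (fun t : List Bool × Literal ℕ => (t.1.getD t.2.1 false == t.2.2)) :=
    (CodeFP.beq bitE_injective).comp
      ((strGetDNat.comp ((CodeFP.fst _ _).pair (CodeFP.snd _ _).fst')).pair (CodeFP.snd _ _).snd')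
  have hclause : CodeFP (pairE strE (rawE litE)) bitE
      (fun t : List Bool × Clause ℕ => t.2.any fun l => (t.1.getD l.1 false == l.2)) :=
    CodeFP.any hlit
  have hall : CodeFP (pairE strE (rawE (rawE litE))) bitE
      (fun t : List Bool × CNF ℕ => t.2.all fun c => c.any fun l => (t.1.getD l.1 false == l.2)) :=
    CodeFP.all hclause
  exact (hall.comp ((CodeFP.snd cnfE strE).pair (cnfRawOfList.comp (CodeFP.fst cnfE strE)))).congr
    fun p => by rfl

/-- **The solution test on codes**: `((φ, w), z) ↦ [w ++ z ∈ Sol φ]`. [folklore] -/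
theorem codeFP_solPred : CodeFP (pairE (pairE cnfE strE) strE) bitE
    (fun a : (CNF ℕ × List Bool) × List Bool =>
      decide ((a.1.2 ++ a.2).length = a.1.1.numVars) &&
        a.1.1.eval fun i => (a.1.2 ++ a.2).getD i false) := by
  have hφ : CodeFP (pairE (pairE cnfE strE) strE) cnfE
      (fun a : (CNF ℕ × List Bool) × List Bool => a.1.1) := (CodeFP.fst _ _).fst'
  have hwz : CodeFP (pairE (pairE cnfE strE) strE) strE
      (fun a : (CNF ℕ × List Bool) × List Bool => a.1.2 ++ a.2) :=
    strAppend.comp ((CodeFP.fst _ _).snd'.pair (CodeFP.snd _ _))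
  -- `numVars` on codes: the tree's `Expander.E3LC.numVarsFP`, re-typed over `SumcheckMA.cnfE`
  have hnv : CodeFP cnfE natE CNF.numVars := by
    have h := Expander.E3LC.numVarsFP
    unfold Expander.E3LC.cnfE at h
    exact h
  exact (natEq.comp ((strNatLength.comp hwz).pair (hnv.comp hφ))).and
    (codeFP_evalStr.comp (hφ.pair hwz))

/-! ### The counting relation and its approximate counter -/

/-- **The counting relation.** There is `R ∈ P` with
`⟨⟨enc φ, w⟩, z⟩ ∈ R ↔ w ++ z ∈ Sol φ`; hence `countWitnesses R (n - |w|) ⟨enc φ, w⟩ = extCount φ w`.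
[cite: JerrumValiantVazirani1986, §3 (self-reducibility)] -/
theorem exists_solRel : ∃ R : Language Bool, R ∈ Classes.P ∧
    ∀ (φ : CNF ℕ) (w : List Bool),
      countWitnesses R (φ.numVars - w.length) (boolPair (encodingCNF.encode φ) w) = extCount φ w := by
  classical
  obtain ⟨f, hf, hfeq⟩ := codeFP_solPred
  set g : List Bool → List Bool := eqPairFn ∘ fanoutFn f (fun _ => [true]) with hg
  have hgFP : g ∈ FP := comp_mem_FP eqPairFn_mem_FP (fanoutFn_mem_FP hf (const_mem_FP _))
  have hg1 : ∀ u, g u = [decide (f u = [true])] := fun u => by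
    simp [hg, fanoutFn_apply, eqPairFn_boolPair]
  refine ⟨{u | g u = [true]}, mem_P_of_mem_FP hgFP _ (fun u => ⟨fun h => h, fun h => ?_⟩), fun φ w => ?_⟩
  · have h' : ¬ g u = [true] := h
    rw [hg1] at h' ⊢
    simpa using h'
  · unfold countWitnesses extCount cnt
    congr 1
    refine Finset.filter_congr fun z _ => ?_
    have h : f (boolPair (boolPair (encodingCNF.encode φ) w) z.toList) =
        bitE (decide ((w ++ z.toList).length = φ.numVars) &&
          φ.eval fun i => (w ++ z.toList).getD i false) := by
      have h0 := hfeq ((φ, w), z.toList)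
      simp only [pairE_apply] at h0
      rw [← cnfE_eq] at h0
      exact h0
    change g (boolPair (boolPair (encodingCNF.encode φ) w) z.toList) = [true] ↔ w ++ z.toList ∈ Sol φ
    rw [hg1, mem_Sol_iff, h]
    simp [bitE]

/-- **The approximate counter of the extension counts** (Stockmeyer's theorem at the empty oracle,
`StockMachine.stockmeyerApproxCounting_holds`, for the relation of `exists_solRel`): an `NP`
language `L`, a polynomial-time oracle transducer `F ∈ FP^L` and a coin polynomial `c` such that
for every CNF `φ`, prefix `w` and `k ≥ 1`, the estimate
`countEstimate F ⟨enc φ, w⟩ (n - |w|) k k u` is within the factor `1 + 1/k` of `extCount φ w` for all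
but a fraction `≤ 1/k` of the coin strings `u` of length `c(|⟨enc φ, w⟩| + (n - |w|) + k + k)`.
[cite: Stockmeyer1985, Thm. 3.1; AaronsonArkhipovToC2013, Thm. 4.1] -/
theorem exists_counter : ∃ L ∈ Nondeterministic.NP, ∃ F ∈ FPRel (Oracle.ofLanguage L),
    ∃ c : Polynomial ℕ, ∀ (φ : CNF ℕ) (w : List Bool) (k : ℕ), 0 < k →
      uniformProb (c.eval ((boolPair (encodingCNF.encode φ) w).length + (φ.numVars - w.length) + k + k))
        {u | ¬ IsApproxCount k (extCount φ w)
          (countEstimate F (boolPair (encodingCNF.encode φ) w) (φ.numVars - w.length) k k u)} ≤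
        1 / (k : ℝ) := by
  obtain ⟨R, hR, hcount⟩ := exists_solRel
  obtain ⟨L, hL, F, hF, c, hc⟩ :=
    StockMachine.stockmeyerApproxCounting_holds Oracle.empty R (P_subset_PRel_holds Oracle.empty hR)
  rw [NPRel_empty] at hL
  refine ⟨L, hL, F, hF, c, fun φ w k hk => ?_⟩
  have h := hc (boolPair (encodingCNF.encode φ) w) (φ.numVars - w.length) k k hk hk
  rw [hcount φ w] at h
  exact h

end Summit.PneNP.PneNP.Theorems.SatBridgeJVV
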